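import Literature.NumberTheory.Automorphic.SLTwoTreeAsLatticeTree            -- ★ F0P3a-p04 (g13) (W0) p843564: `X = latticeTree id ϖ J`, `isSelfDualLattice_id_altJ_iff`, `isModularLattice_id_altJ_iff`
import Literature.NumberTheory.Automorphic.HermitianLatticeTreeFrames          -- ★ A-p17: `valuation_zpow_eq_one_iff`
import Literature.NumberTheory.Automorphic.HermitianLatticeTreeDiagonal        -- ★ A-p17: `scaleLattice_latt`, `latt_mul_of_mem_glInt`, `mapGL_*`
import Literature.NumberTheory.Automorphic.IwasawaDecompositionGL              -- ★ `exists_eq_zpow_mul_of_ne_zero`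
import HarnessLib

/-!
# The action of `GL₂(F)` (through `PGL₂(F)`) on the vertices of the tree of `SL₂(F)` — homothety classes of lattices (Serre, *Trees* II.1.1–1.3)

Topic `NumberTheory/Automorphic`; namespace `Literature.NumberTheory.Automorphic.HermitianLatticeTree`.  ONE definition (`glVertexAct`) and theorems; no instance, no
notation, no named fact, no `sorry`.  Cell `pub/hodgecm-mathlib` (D-0151), crux H413 (stmt-HodgeConjecture-24833), line «N6nsGerm», (R2) `stub_N6nsR2EP` ∕ residue
`RankOneEulerPoincareNonsplitRamified` — ROAD W («R2EP-wild», MEMO `F0/P3a/F0P3a-p04/g13/MEMO-R2wild.F0P3a-p04g13.md`), brick (W1c)-A: seat B-p08 (g28) (LEAD F0P3a-plan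
(g10) T9-18 (3); B-p14 (g32) 10:23:49Z hands: (W1c)(W2) B-p08, (W3)(W4) B-p14, (W5) F0P2-p02).  HONEST LABEL: HC_CM is proved only modulo the cell's remaining named inputs
(hLiu418, h413) until rung 0 closes; nothing printed is asserted here.

THE MATHEMATICS.  `F` discretely valued with uniformiser `ϖ`, `J = !![0, 1; −1, 0]`, `X = latticeTree (RingHom.id F) ϖ J` (★ (W0): vertices = lattices `latt h` with
`|det h| ∈ {1, |ϖ|}` = ONE representative per homothety class, Serre II.1.1 Thm 1).  `GL₂(F)` acts on homothety classes: `g · [Λ] = [gΛ]`; on representatives,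
**`glVertexAct ϖ g (latt h) :=` the unique special lattice `ϖ^k · latt (g h)`** (`2k ≡ −ord det(gh)` rounded: §1 `existsUnique`-style lemmas `exists_zpow_isSpecialLattice`,
`zpow_eq_zero_of_isSpecialLattice`).  Consequences: `glVertexAct_eq_iff` (the characterisation «same homothety class»), `glVertexAct_one`, `glVertexAct_mul` (an action),
`glVertexAct_smul` (homotheties `c • g`, `c ∈ F^×`, act like `g`: the action FACTORS THROUGH `PGL₂(F)`), `glVertexAct_of_valuation_det_eq_one` (for `|det g| = 1`, e.g.
`g ∈ SL₂(F) = U(id, J)`, no rescaling: `g · latt h = latt (g h)`).  Sequel (W1c)-B: `U(Φ₂)(E_w)` acts through `ρ : U → PGL₂(F_v)` (★ p843570); (W2): stabilisers by type.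

## References
* [Serre1980Trees] J.-P. Serre, *Trees* (1980), Ch. II §1.1 Theorem 1, §1.2–§1.3 (the tree of `SL₂`; `GL₂` acts through `PGL₂`, with inversions).
* [Kottwitz1988] R. E. Kottwitz, *Tamagawa numbers*, Ann. of Math. 127 (1988), §2.
* [BruhatTits1972] F. Bruhat, J. Tits, *Groupes réductifs sur un corps local I*, Publ. IHÉS 41 (1972), §10.
-/

set_option autoImplicit false

noncomputable section

open scoped ValuativeRel Matrix MatrixGroups
open Matrix ValuativeRel

namespace Literature.NumberTheory.Automorphic.HermitianLatticeTree

variable {F : Type*} [Field F] [ValuativeRel F] {ϖ : F} (hϖ : IsUniformizingElement ϖ)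

/-! ## §1 Homothety classes: exactly one special representative -/

section Homothety

/-- A special lattice for `(id, J)` is `latt h` with `|det h| = |ϖ^e|`, `e ∈ {0, 1}`. [cite: Serre1980Trees, Ch. II §1.1 Theorem 1] -/
theorem exists_latt_eq_of_isSpecialLattice (h0 : ϖ ≠ 0) {M : Submodule 𝒪[F] (Fin 2 → F)}
    (hM : IsSpecialLattice (RingHom.id F) ϖ !![(0 : F), 1; -1, 0] M) :
    ∃ (h : GL (Fin 2) F) (e : ℤ), (e = 0 ∨ e = 1) ∧ M = latt (h : Matrix (Fin 2) (Fin 2) F) ∧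
      valuation F (h : Matrix (Fin 2) (Fin 2) F).det = valuation F (ϖ ^ e) := by
  rcases hM with hM | hM
  · obtain ⟨h, rfl, hdet⟩ := (isSelfDualLattice_id_altJ_iff M).1 hM
    exact ⟨h, 0, Or.inl rfl, rfl, by rw [hdet, zpow_zero, map_one]⟩
  · obtain ⟨h, rfl, hdet⟩ := (isModularLattice_id_altJ_iff h0 M).1 hM
    exact ⟨h, 1, Or.inr rfl, rfl, by rw [hdet, zpow_one]⟩

/-- Conversely `latt h` with `|det h| = |ϖ^e|`, `e ∈ {0,1}`, is special. [cite: Serre1980Trees, Ch. II §1.1 Theorem 1] -/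
theorem isSpecialLattice_latt_of_valuation_det (h0 : ϖ ≠ 0) (h : GL (Fin 2) F) {e : ℤ} (he : e = 0 ∨ e = 1)
    (hdet : valuation F (h : Matrix (Fin 2) (Fin 2) F).det = valuation F (ϖ ^ e)) :
    IsSpecialLattice (RingHom.id F) ϖ !![(0 : F), 1; -1, 0] (latt (h : Matrix (Fin 2) (Fin 2) F)) := by
  rcases he with rfl | rfl
  · exact Or.inl ((isSelfDualLattice_id_altJ_iff _).2 ⟨h, rfl, by rw [hdet, zpow_zero, map_one]⟩)
  · exact Or.inr ((isModularLattice_id_altJ_iff h0 _).2 ⟨h, rfl, by rw [hdet, zpow_one]⟩)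

/-- The scalar matrix `ϖ^k • 1` as an element of `GL₂(F)` times `h`: `ϖ^k · latt h = latt (ϖ^k • h)` and `det (ϖ^k • h) = ϖ^{2k} det h`.
[cite: Serre1980Trees, Ch. II §1.1] -/
theorem valuation_det_smul (c : F) (h : Matrix (Fin 2) (Fin 2) F) :
    valuation F (c • h).det = valuation F c ^ 2 * valuation F h.det := by
  rw [Matrix.det_smul, Fintype.card_fin, map_mul, map_pow]

/-- `latt (c • h) = latt h′` (`c ≠ 0`) forces `|det (c • h)| = |det h′|` (the two bases differ by `GL₂(𝒪)`). [cite: Serre1980Trees, Ch. II §1.1] -/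
theorem valuation_det_eq_of_latt_smul_eq {c : F} (hc : c ≠ 0) (h h' : GL (Fin 2) F)
    (hh' : latt (c • (h : Matrix (Fin 2) (Fin 2) F)) = latt (h' : Matrix (Fin 2) (Fin 2) F)) :
    valuation F (c • (h : Matrix (Fin 2) (Fin 2) F)).det = valuation F (h' : Matrix (Fin 2) (Fin 2) F).det := by
  have hdet : (c • (h : Matrix (Fin 2) (Fin 2) F)).det ≠ 0 := by
    rw [Matrix.det_smul, Fintype.card_fin]
    exact mul_ne_zero (pow_ne_zero _ hc) (h.isUnit.map Matrix.detMonoidHom).ne_zero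
  set g : GL (Fin 2) F := Matrix.GeneralLinearGroup.mk'' (c • (h : Matrix (Fin 2) (Fin 2) F)) (isUnit_iff_ne_zero.2 hdet) with hg
  have hgval : (g : Matrix (Fin 2) (Fin 2) F) = c • (h : Matrix (Fin 2) (Fin 2) F) := rfl
  rw [← hgval] at hh' ⊢
  have hk := (span_range_transpose_eq_iff h' g).1 hh'.symm
  have heq : g = h' * (h'⁻¹ * g) := by rw [mul_inv_cancel_left]
  rw [heq, Units.val_mul, Matrix.det_mul, map_mul, valuation_det_eq_one_of_mem_glInt hk, mul_one]

include hϖ in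
/-- **RIGIDITY of the special representative**: if `M` and `ϖ^k · M` are both special then `k = 0` (the determinant exponents are `e` and `2k + e` with
`e, 2k + e ∈ {0, 1}`). [cite: Serre1980Trees, Ch. II §1.1 Theorem 1] -/
theorem zpow_eq_zero_of_isSpecialLattice [IsDiscreteValuationRing 𝒪[F]] {M : Submodule 𝒪[F] (Fin 2 → F)}
    (hM : IsSpecialLattice (RingHom.id F) ϖ !![(0 : F), 1; -1, 0] M) {k : ℤ}
    (hk : IsSpecialLattice (RingHom.id F) ϖ !![(0 : F), 1; -1, 0] (scaleLattice (ϖ ^ k) M)) : k = 0 := by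
  have h0 := hϖ.ne_zero
  have hv0 : valuation F ϖ ≠ 0 := (Valuation.ne_zero_iff _).2 h0
  obtain ⟨h, e, he, rfl, hdet⟩ := exists_latt_eq_of_isSpecialLattice h0 hM
  rw [scaleLattice_latt] at hk
  obtain ⟨h', e', he', hh', hdet'⟩ := exists_latt_eq_of_isSpecialLattice h0 hk
  have hval := valuation_det_eq_of_latt_smul_eq (zpow_ne_zero k h0) h h' hh'
  rw [valuation_det_smul, hdet, hdet', map_zpow₀, map_zpow₀, map_zpow₀, ← zpow_natCast, ← _root_.zpow_mul, ← zpow_add₀ hv0] at hval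
  have hinj : k * ((2 : ℕ) : ℤ) + e = e' := by
    by_contra hne
    have h1 : valuation F ϖ ^ (k * ((2 : ℕ) : ℤ) + e - e') = 1 := by
      rw [zpow_sub₀ hv0, hval, div_self (zpow_ne_zero _ hv0)]
    have := (valuation_zpow_eq_one_iff hϖ _).1 h1
    omega
  push_cast at hinj
  rcases he with rfl | rfl <;> rcases he' with rfl | rfl <;> omega

include hϖ in
/-- **EXISTENCE of the special representative**: every `latt h` (`h ∈ GL₂(F)`) has a special homothetic lattice `ϖ^k · latt h` (`k = −⌊ord det h ∕ 2⌋`).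
[cite: Serre1980Trees, Ch. II §1.1 Theorem 1] -/
theorem exists_zpow_isSpecialLattice [IsDiscreteValuationRing 𝒪[F]] (h : GL (Fin 2) F) :
    ∃ k : ℤ, IsSpecialLattice (RingHom.id F) ϖ !![(0 : F), 1; -1, 0] (scaleLattice (ϖ ^ k) (latt (h : Matrix (Fin 2) (Fin 2) F))) := by
  have h0 := hϖ.ne_zero
  have hv0 : valuation F ϖ ≠ 0 := (Valuation.ne_zero_iff _).2 h0
  have hdet0 : (h : Matrix (Fin 2) (Fin 2) F).det ≠ 0 := (h.isUnit.map Matrix.detMonoidHom).ne_zero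
  obtain ⟨m, u, hu, hm⟩ := exists_eq_zpow_mul_of_ne_zero hϖ hdet0
  refine ⟨-(m / 2), ?_⟩
  rw [scaleLattice_latt]
  have hdet : (ϖ ^ (-(m / 2)) • (h : Matrix (Fin 2) (Fin 2) F)).det ≠ 0 := by
    rw [Matrix.det_smul, Fintype.card_fin]; exact mul_ne_zero (pow_ne_zero _ (zpow_ne_zero _ h0)) hdet0
  set g : GL (Fin 2) F := Matrix.GeneralLinearGroup.mk'' _ (isUnit_iff_ne_zero.2 hdet) with hg
  have hgval : (g : Matrix (Fin 2) (Fin 2) F) = ϖ ^ (-(m / 2)) • (h : Matrix (Fin 2) (Fin 2) F) := rfl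
  rw [← hgval]
  refine isSpecialLattice_latt_of_valuation_det h0 g (e := m % 2) (by omega) ?_
  rw [hgval, valuation_det_smul, hm, map_mul, hu, mul_one, map_zpow₀, map_zpow₀, map_zpow₀, ← zpow_natCast, ← _root_.zpow_mul, ← zpow_add₀ hv0]
  congr 1
  omega

end Homothety

/-! ## §2 The action of `GL₂(F)` on the vertices of `X` -/

section Action

variable [IsDiscreteValuationRing 𝒪[F]]

include hϖ in
/-- Every vertex `M` and `g ∈ GL₂(F)` have a special lattice homothetic to `g · M`. [cite: Serre1980Trees, Ch. II §1.2] -/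
theorem exists_zpow_isSpecialLattice_mapGL (g : GL (Fin 2) F)
    (M : {M : Submodule 𝒪[F] (Fin 2 → F) // IsSpecialLattice (RingHom.id F) ϖ !![(0 : F), 1; -1, 0] M}) :
    ∃ k : ℤ, IsSpecialLattice (RingHom.id F) ϖ !![(0 : F), 1; -1, 0] (scaleLattice (ϖ ^ k) (mapGL g M.1)) := by
  obtain ⟨h, e, -, hM, -⟩ := exists_latt_eq_of_isSpecialLattice hϖ.ne_zero M.2
  rw [hM, mapGL_latt]
  exact exists_zpow_isSpecialLattice hϖ (g * h)

/-- **THE VERTEX ACTION of `GL₂(F)` on the tree of `SL₂(F)`**: `g · M :=` the special representative of the homothety class of `g M` (Serre: `GL₂` acts on the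
classes of lattices; on Serre's normalised representatives this is the action through `PGL₂(F)`). [cite: Serre1980Trees, Ch. II §1.2–§1.3] -/
def glVertexAct (hϖ : IsUniformizingElement ϖ) (g : GL (Fin 2) F)
    (M : {M : Submodule 𝒪[F] (Fin 2 → F) // IsSpecialLattice (RingHom.id F) ϖ !![(0 : F), 1; -1, 0] M}) :
    {M : Submodule 𝒪[F] (Fin 2 → F) // IsSpecialLattice (RingHom.id F) ϖ !![(0 : F), 1; -1, 0] M} :=
  ⟨scaleLattice (ϖ ^ Classical.choose (exists_zpow_isSpecialLattice_mapGL hϖ g M)) (mapGL g M.1),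
    Classical.choose_spec (exists_zpow_isSpecialLattice_mapGL hϖ g M)⟩

include hϖ in
/-- **CHARACTERISATION**: `g · M = N` iff `N` is homothetic to `g M` by a power of `ϖ` (the special representative is unique, `zpow_eq_zero_of_isSpecialLattice`).
[cite: Serre1980Trees, Ch. II §1.1 Theorem 1] -/
theorem glVertexAct_eq_iff (g : GL (Fin 2) F)
    (M N : {M : Submodule 𝒪[F] (Fin 2 → F) // IsSpecialLattice (RingHom.id F) ϖ !![(0 : F), 1; -1, 0] M}) :
    glVertexAct hϖ g M = N ↔ ∃ k : ℤ, N.1 = scaleLattice (ϖ ^ k) (mapGL g M.1) := by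
  have h0 := hϖ.ne_zero
  constructor
  · rintro rfl
    exact ⟨_, rfl⟩
  · rintro ⟨k, hk⟩
    apply Subtype.ext
    show scaleLattice (ϖ ^ Classical.choose (exists_zpow_isSpecialLattice_mapGL hϖ g M)) (mapGL g M.1) = N.1
    -- both sides are special and homothetic: `N = ϖ^(k − k₀) · (g·M)`
    have hspec := Classical.choose_spec (exists_zpow_isSpecialLattice_mapGL hϖ g M)
    have hrel : N.1 = scaleLattice (ϖ ^ (k - Classical.choose (exists_zpow_isSpecialLattice_mapGL hϖ g M)))
        (scaleLattice (ϖ ^ Classical.choose (exists_zpow_isSpecialLattice_mapGL hϖ g M)) (mapGL g M.1)) := by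
      rw [scaleLattice_scaleLattice, ← zpow_add₀ h0, sub_add_cancel, ← hk]
    have hN := N.2
    rw [hrel] at hN
    have hzero := zpow_eq_zero_of_isSpecialLattice hϖ hspec hN
    rw [hrel, hzero, zpow_zero, scaleLattice_one]

include hϖ in
/-- `1 · M = M`. [cite: Serre1980Trees, Ch. II §1.2] -/
theorem glVertexAct_one (M : {M : Submodule 𝒪[F] (Fin 2 → F) // IsSpecialLattice (RingHom.id F) ϖ !![(0 : F), 1; -1, 0] M}) :
    glVertexAct hϖ 1 M = M :=
  (glVertexAct_eq_iff hϖ 1 M M).2 ⟨0, by rw [zpow_zero, scaleLattice_one, mapGL_one]⟩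

include hϖ in
/-- `(g g′) · M = g · (g′ · M)` — `glVertexAct` is an action of `GL₂(F)`. [cite: Serre1980Trees, Ch. II §1.2] -/
theorem glVertexAct_mul (g g' : GL (Fin 2) F) (M : {M : Submodule 𝒪[F] (Fin 2 → F) // IsSpecialLattice (RingHom.id F) ϖ !![(0 : F), 1; -1, 0] M}) :
    glVertexAct hϖ (g * g') M = glVertexAct hϖ g (glVertexAct hϖ g' M) := by
  obtain ⟨k', hk'⟩ := (glVertexAct_eq_iff hϖ g' M _).1 rfl
  obtain ⟨k, hk⟩ := (glVertexAct_eq_iff hϖ g (glVertexAct hϖ g' M) _).1 rfl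
  refine (glVertexAct_eq_iff hϖ (g * g') M _).2 ⟨k + k', ?_⟩
  rw [hk, hk', mapGL_scaleLattice, scaleLattice_scaleLattice, ← zpow_add₀ hϖ.ne_zero, mapGL_mul]

omit [IsDiscreteValuationRing 𝒪[F]] in
/-- Scaling by a unit scalar does not change a lattice of the form `latt h`. [cite: Serre1980Trees, Ch. II §1.1] -/
theorem scaleLattice_latt_eq_of_valuation_eq_one {u : F} (hu : valuation F u = 1) (h : GL (Fin 2) F) :
    scaleLattice u (latt (h : Matrix (Fin 2) (Fin 2) F)) = latt (h : Matrix (Fin 2) (Fin 2) F) := by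
  have hu0 : u ≠ 0 := fun h0 => by rw [h0, map_zero] at hu; exact zero_ne_one hu
  set c : GL (Fin 2) F := (Units.mk0 u hu0).map ((Matrix.scalar (Fin 2) : F →+* Matrix (Fin 2) (Fin 2) F) : F →* Matrix (Fin 2) (Fin 2) F) with hc
  have hcval : (c : Matrix (Fin 2) (Fin 2) F) = u • (1 : Matrix (Fin 2) (Fin 2) F) := by
    rw [hc, Units.coe_map]; simp [Matrix.scalar_apply, Matrix.smul_one_eq_diagonal]
  have hcK : c ∈ glInt 2 F := by
    refine mem_glInt_of_isIntegralMatrix (fun i j => ?_) (by rw [hcval, Matrix.det_smul, Matrix.det_one, mul_one, Fintype.card_fin, map_pow, hu, one_pow])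
    rw [hcval, Matrix.smul_apply, Matrix.one_apply]
    split_ifs
    · rw [smul_eq_mul, mul_one]; exact (Valuation.mem_integer_iff _ _).2 hu.le
    · rw [smul_zero]; exact zero_mem _
  have hmul : u • (h : Matrix (Fin 2) (Fin 2) F) = ((h * c : GL (Fin 2) F) : Matrix (Fin 2) (Fin 2) F) := by
    rw [Units.val_mul, hcval, Matrix.mul_smul, Matrix.mul_one]
  rw [scaleLattice_latt, hmul, latt_mul_of_mem_glInt _ _ hcK]

include hϖ in
/-- **HOMOTHETIES ACT TRIVIALLY**: `(c • 1) g · M = g · M` for `c ∈ F^×` — the vertex action of `GL₂(F)` factors through `PGL₂(F)`. [cite: Serre1980Trees, Ch. II §1.2] -/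
theorem glVertexAct_scalar_mul (c : Fˣ) (g : GL (Fin 2) F)
    (M : {M : Submodule 𝒪[F] (Fin 2 → F) // IsSpecialLattice (RingHom.id F) ϖ !![(0 : F), 1; -1, 0] M}) :
    glVertexAct hϖ (c.map ((Matrix.scalar (Fin 2) : F →+* Matrix (Fin 2) (Fin 2) F) : F →* Matrix (Fin 2) (Fin 2) F) * g) M = glVertexAct hϖ g M := by
  have h0 := hϖ.ne_zero
  obtain ⟨k, hk⟩ := (glVertexAct_eq_iff hϖ g M _).1 rfl
  -- `c = ϖ^a · e` with `e` a unit
  obtain ⟨a, e, he, hce⟩ := exists_eq_zpow_mul_of_ne_zero hϖ c.ne_zero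
  obtain ⟨h, -, -, hM, -⟩ := exists_latt_eq_of_isSpecialLattice h0 M.2
  refine (glVertexAct_eq_iff hϖ _ M _).2 ⟨k - a, ?_⟩
  -- `(c•1) g · latt h = latt ((c • 1) g h) = c · latt (g h)`
  have hscal : mapGL (c.map ((Matrix.scalar (Fin 2) : F →+* Matrix (Fin 2) (Fin 2) F) : F →* Matrix (Fin 2) (Fin 2) F) * g) M.1 =
      scaleLattice (c : F) (mapGL g M.1) := by
    rw [hM, mapGL_latt, mapGL_latt, scaleLattice_latt, Units.val_mul, Units.val_mul, Units.coe_map]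
    congr 1
    simp [Matrix.scalar_apply, Matrix.mul_assoc, Matrix.smul_eq_diagonal_mul]
  have hexp : ϖ ^ (k - a) * (ϖ ^ a * e) = ϖ ^ k * e := by rw [← mul_assoc, ← zpow_add₀ h0, sub_add_cancel]
  rw [hk, hscal, scaleLattice_scaleLattice, hce, hM, mapGL_latt, hexp, ← scaleLattice_scaleLattice, scaleLattice_latt_eq_of_valuation_eq_one he]

end Action

end Literature.NumberTheory.Automorphic.HermitianLatticeTree

end
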